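import Literature.AlgebraicGeometry.Frobenioids.PadicFrobenioidPullbacks
import Literature.AlgebraicGeometry.Frobenioids.RealificationRPow
import HarnessLib

/-!
# Frobenioids II, Example 1.1 (i): `Φ₀^Λ` "is isomorphic to the constant monoid determined by `ℝ_{≥0}`"

Mochizuki, *The geometry of Frobenioids II*, Kyushu J. Math. **62** (2008) 401–460, §1 Example 1.1 (i),
author's text p. 8 [cite: MochizukiFrdII2008, Ex 1.1 (i) p.8]: "Note that the monoid `Φ₀^Λ` is isomorphic
to the constant monoid determined by `ℝ_{≥0} ∈ Ob(Mon)` on `D₀`; in particular, the Frobenioid `C₀^ℝ` may be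
naturally identified with the elementary Frobenioid determined by this constant monoid." (Recall from
p. 7–8 that `Φ₀ : Spec(K) ↦ ord(O_K^⊳)^rlf (≅ ℝ_{≥0})` and `Φ₀^ℚ := Φ₀`, `Φ₀^ℝ := Φ₀`, so the claim is about
`Φ₀` for every monoid type `Λ`.)

This file PROVES the first printed claim for the tree's `Φ₀` (`PadicFrd.phiZero`, `PadicFrobenioidZero.lean`)
restricted along any base `D → D₀` of `p`-adic local fields (`PadicFrd.phiZeroOn base`, the `Φ₀|_D` of
Example 1.1 (ii); `D = D₀` is the printed case): there is an isomorphism of functors `D^op → Mon`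

  `Φ₀|_D ≅ (the constant functor with value ℝ_{≥0})`                     (`PadicFrd.phiZeroIsoConst`)

whose component at `A ↦ Spec K` is evaluation of `ord(O_K^⊳) ⊗ ℝ_{≥0} = Hom(Hom(ord(O_K^⊳), ℝ_{≥0}), ℝ_{≥0})`
at the NORMALISED `p`-adic order `ord_p : ord(O_K^⊳) → ℝ_{≥0}`, `ord_p(p) = 1` (`PadicFld.pExponent`); the
normalisation at `p` (rather than at a uniformiser) is what makes the isomorphism natural in `K`: along
`Spec K → Spec L` the order `ord_p` on `K` restricts to `ord_p` on `L` (`pExponent_comp_ordIntMapOfHom`),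
because both take the value `1` at `p` and a homomorphism `ord(O_L^⊳) ≅ ℤ_{≥0} → ℝ_{≥0}` is determined by
one nonzero value (`IsZMonoprime.rDual_ext`).

Supporting algebra (generic, `M ≅ ℤ_{≥0}`): elements of `M ⊗ ℝ_{≥0}` are determined by one value
(`Realification.toAdd_toHom_eq`: `x(g) = x(δ) · g(gen)` with `δ` the degree), and evaluation at any
`ν ≠ 1` is a bijection `M ⊗ ℝ_{≥0} → ℝ_{≥0}` (`Realification.evalAt_bijective`). The constant functor
is valued in `ULift ℝ_{≥0}` only to live in the universe of `Φ₀|_D`. The second printed claim (`C₀^ℝ` vs.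
the elementary Frobenioid) concerns [FrdI] Prop. 5.5 realifications (abc-iut-L1-t2's files) and is not
treated here. No statement of the paper is strengthened; nothing here bears on [IUTchIII].
-/

namespace Literature.AlgebraicGeometry.Frobenioids

open CategoryTheory Opposite Function
open scoped NNReal

universe v u

/-! ### Generic: evaluation maps `M ⊗ ℝ_{≥0} → ℝ_{≥0}` and the structure of `M ⊗ ℝ_{≥0}` for `M ≅ ℤ_{≥0}` -/

namespace Realification

section Eval

variable {M N : Type u} [CommMonoid M] [CommMonoid N]

/-- Evaluation of `M ⊗ ℝ_{≥0} = Hom(M^∨, ℝ_{≥0})` at `ν ∈ M^∨ = Hom(M, ℝ_{≥0})`, a monoid homomorphism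
`M ⊗ ℝ_{≥0} → ℝ_{≥0}`. [cite: MochizukiFrdI2008, §0 p.10] -/
def evalAt (ν : RDual M) : Realification M →* Multiplicative ℝ≥0 where
  toFun x := x.toHom ν
  map_one' := by rw [Realification.toHom_one, MonoidHom.one_apply]
  map_mul' x y := by rw [Realification.toHom_mul, MonoidHom.mul_apply]

/-- The value of `evalAt`. [cite: MochizukiFrdI2008, §0 p.10] -/
@[simp] theorem evalAt_apply (ν : RDual M) (x : Realification M) : evalAt ν x = x.toHom ν := rfl

/-- On `M ⊆ M ⊗ ℝ_{≥0}`, evaluation at `ν` is `ν`. [cite: MochizukiFrdI2008, §0 p.10] -/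
theorem evalAt_of (ν : RDual M) (a : M) : evalAt ν (Realification.of M a) = ν a := rfl

/-- Evaluation is compatible with functoriality: `ev_ν ∘ (φ ⊗ ℝ_{≥0}) = ev_{ν ∘ φ}`.
[cite: MochizukiFrdI2008, §0 p.10] -/
theorem evalAt_map (φ : M →* N) (ν : RDual N) (x : Realification M) :
    evalAt ν (Realification.map φ x) = evalAt (ν.comp φ) x := rfl

end Eval

section ZMonoprime

variable {M : Type u} [CommMonoid M] (eM : M ≃* Multiplicative ℕ)

/-- `deg(gen) = 1`. [cite: MochizukiFrdI2008, §0 p.10] -/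
theorem zdeg_zgen : zdeg eM (zgen eM) = 1 := by
  have h := zdeg_zgen_pow eM 1
  rwa [pow_one] at h

/-- `rDualOfValue 0 = 1`. [cite: MochizukiFrdI2008, §0 p.10] -/
theorem rDualOfValue_zero : rDualOfValue eM 0 = 1 :=
  MonoidHom.ext fun n => Multiplicative.toAdd.injective (by
    rw [toAdd_rDualOfValue_apply, mul_zero, MonoidHom.one_apply, toAdd_one])

/-- `rDualOfValue (c + c') = rDualOfValue c · rDualOfValue c'`. [cite: MochizukiFrdI2008, §0 p.10] -/
theorem rDualOfValue_add (c c' : ℝ≥0) :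
    rDualOfValue eM (c + c') = rDualOfValue eM c * rDualOfValue eM c' :=
  MonoidHom.ext fun n => Multiplicative.toAdd.injective (by
    rw [toAdd_rDualOfValue_apply, MonoidHom.mul_apply, toAdd_mul, toAdd_rDualOfValue_apply,
      toAdd_rDualOfValue_apply, mul_add])

/-- The value of `rDualOfValue c` at the generator is `c`. [cite: MochizukiFrdI2008, §0 p.10] -/
theorem toAdd_rDualOfValue_zgen (c : ℝ≥0) :
    Multiplicative.toAdd (rDualOfValue eM c (zgen eM)) = c := by
  rw [toAdd_rDualOfValue_apply, zdeg_zgen, Nat.cast_one, one_mul]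

/-- Every `g ∈ M^∨` is `rDualOfValue` of its value at the generator. [cite: MochizukiFrdI2008, §0 p.10] -/
theorem rDualOfValue_toAdd_apply_zgen (g : RDual M) :
    rDualOfValue eM (Multiplicative.toAdd (g (zgen eM))) = g :=
  MonoidHom.ext fun n => Multiplicative.toAdd.injective (by
    rw [toAdd_rDualOfValue_apply, toAdd_rDual_apply eM g n])

/-- **Elements of `M ⊗ ℝ_{≥0}` (`M ≅ ℤ_{≥0}`) are determined by one value**: for `x ∈ Hom(M^∨, ℝ_{≥0})`,
`x(g) = x(δ) · g(gen)` where `δ = rDualOfValue 1` is the degree map — an additive self-map of `ℝ_{≥0}`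
is a homothety. [cite: MochizukiFrdI2008, §0 p.10] -/
theorem toAdd_toHom_eq (x : Realification M) (g : RDual M) :
    Multiplicative.toAdd (x.toHom g) =
      Multiplicative.toAdd (x.toHom (rDualOfValue eM 1)) * Multiplicative.toAdd (g (zgen eM)) := by
  let F : ℝ≥0 →+ ℝ≥0 :=
    { toFun := fun c => Multiplicative.toAdd (x.toHom (rDualOfValue eM c))
      map_zero' := by
        change Multiplicative.toAdd (x.toHom (rDualOfValue eM 0)) = 0
        rw [rDualOfValue_zero, map_one, toAdd_one]
      map_add' := fun c c' => by
        change Multiplicative.toAdd (x.toHom (rDualOfValue eM (c + c'))) = _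
        rw [rDualOfValue_add, map_mul, toAdd_mul] }
  have hF := addMonoidHom_nnreal_apply F (Multiplicative.toAdd (g (zgen eM)))
  conv_lhs => rw [← rDualOfValue_toAdd_apply_zgen eM g]
  exact hF

/-- A homomorphism `ν : M → ℝ_{≥0}` (`M ≅ ℤ_{≥0}`) with `ν ≠ 1` does not vanish at the generator.
[cite: MochizukiFrdI2008, §0 p.10] -/
theorem toAdd_apply_zgen_ne_zero {ν : RDual M} (hν : ν ≠ 1) :
    Multiplicative.toAdd (ν (zgen eM)) ≠ 0 := by
  intro h0
  apply hν
  refine MonoidHom.ext fun n => Multiplicative.toAdd.injective ?_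
  rw [toAdd_rDual_apply eM ν n, h0, mul_zero, MonoidHom.one_apply, toAdd_one]

/-- **Evaluation at a nonzero `ν ∈ M^∨` is a bijection `M ⊗ ℝ_{≥0} ≅ ℝ_{≥0}`** for `M ≅ ℤ_{≥0}` (this is
the isomorphism `ord(O_K^⊳)^rlf ≅ ℝ_{≥0}` of FrdII Ex. 1.1 (i), p. 7, once `ν` is chosen).
[cite: MochizukiFrdII2008, Ex 1.1 (i) p.7] -/
theorem evalAt_bijective (hM : IsZMonoprime M) {ν : RDual M} (hν : ν ≠ 1) : Bijective (evalAt ν) := by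
  obtain ⟨⟨e⟩⟩ := hM
  have hc : Multiplicative.toAdd (ν (zgen e)) ≠ 0 := toAdd_apply_zgen_ne_zero e hν
  constructor
  · intro x y hxy
    have h1 : Multiplicative.toAdd (x.toHom (rDualOfValue e 1)) =
        Multiplicative.toAdd (y.toHom (rDualOfValue e 1)) := by
      have h2 : Multiplicative.toAdd (x.toHom ν) = Multiplicative.toAdd (y.toHom ν) :=
        congrArg Multiplicative.toAdd hxy
      rw [toAdd_toHom_eq e x ν, toAdd_toHom_eq e y ν] at h2
      exact mul_right_cancel₀ hc h2
    refine Realification.ext' fun g => Multiplicative.toAdd.injective ?_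
    rw [toAdd_toHom_eq e x g, toAdd_toHom_eq e y g, h1]
  · intro r
    refine ⟨Realification.rpow (Multiplicative.toAdd r / Multiplicative.toAdd (ν (zgen e)))
      (Realification.of M (zgen e)), Multiplicative.toAdd.injective ?_⟩
    rw [evalAt_apply, Realification.toAdd_toHom_rpow, Realification.toHom_of, div_mul_cancel₀ _ hc]

end ZMonoprime

end Realification

section ZMonoprimeDual

variable {M : Type u} [CommMonoid M]

/-- Two homomorphisms `M ≅ ℤ_{≥0} → ℝ_{≥0}` that agree at one non-identity element agree.
[cite: MochizukiFrdI2008, §0 p.10] -/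
theorem IsZMonoprime.rDual_ext (hM : IsZMonoprime M) {m₀ : M} (hm₀ : m₀ ≠ 1) {g g' : RDual M}
    (h : g m₀ = g' m₀) : g = g' := by
  obtain ⟨⟨e⟩⟩ := hM
  have hk : ((Realification.zdeg e m₀ : ℕ) : ℝ≥0) ≠ 0 := by
    intro h0
    apply hm₀
    rw [Realification.eq_zgen_pow e m₀, show Realification.zdeg e m₀ = 0 by exact_mod_cast h0, pow_zero]
  have hgen : Multiplicative.toAdd (g (Realification.zgen e)) = Multiplicative.toAdd (g' (Realification.zgen e)) := by
    have h3 : Multiplicative.toAdd (g m₀) = Multiplicative.toAdd (g' m₀) := by rw [h]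
    rw [Realification.toAdd_rDual_apply e g m₀, Realification.toAdd_rDual_apply e g' m₀] at h3
    exact mul_left_cancel₀ hk h3
  refine MonoidHom.ext fun n => Multiplicative.toAdd.injective ?_
  rw [Realification.toAdd_rDual_apply e g n, Realification.toAdd_rDual_apply e g' n, hgen]

/-- For `M ≅ ℤ_{≥0}`, a non-identity `m₀` and `c ∈ ℝ_{≥0}` there is a homomorphism `M → ℝ_{≥0}` with value
`c` at `m₀` (namely `n ↦ deg(n) · c / deg(m₀)`). [cite: MochizukiFrdI2008, §0 p.10] -/
theorem IsZMonoprime.exists_rDual_apply_eq (hM : IsZMonoprime M) {m₀ : M} (hm₀ : m₀ ≠ 1) (c : ℝ≥0) :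
    ∃ g : RDual M, g m₀ = Multiplicative.ofAdd c := by
  obtain ⟨⟨e⟩⟩ := hM
  have hk : ((Realification.zdeg e m₀ : ℕ) : ℝ≥0) ≠ 0 := by
    intro h0
    apply hm₀
    rw [Realification.eq_zgen_pow e m₀, show Realification.zdeg e m₀ = 0 by exact_mod_cast h0, pow_zero]
  refine ⟨Realification.rDualOfValue e (c / (Realification.zdeg e m₀ : ℝ≥0)), Multiplicative.toAdd.injective ?_⟩
  rw [Realification.toAdd_rDualOfValue_apply, toAdd_ofAdd, mul_div_cancel₀ c hk]

end ZMonoprimeDual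


/-! ### The normalised `p`-adic order `ord_p : ord(O_K^⊳) → ℝ_{≥0}` of a `p`-adic local field -/

namespace PadicFrd

namespace PadicFld

variable {p : ℕ} [Fact p.Prime]

/-- The class `ord(p) ∈ ord(O_K^⊳)` of `p` (an element of `O_K^⊳` by the definition of the base category).
[cite: MochizukiFrdII2008, Ex 1.1 (i) p.7] -/
def ordP (X : PadicFld.{u} p) : OrdInt X.K := Associates.mk ⟨((p : ℕ) : X.K), X.p_mem⟩

omit [Fact p.Prime] in
/-- `ord(p) ≠ 0`: `p` is not a unit of `O_K` (`v(p) < 1`). [cite: MochizukiFrdII2008, Ex 1.1 (i) p.7] -/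
theorem ordP_ne_one (X : PadicFld.{u} p) : X.ordP ≠ 1 := fun h => by
  rw [ordP, Associates.mk_eq_one] at h
  exact X.p_lt.ne ((isUnit_intNonzero_iff _ _).mp h)

omit [Fact p.Prime] in
/-- Pull-back maps `ord(O_L^⊳) → ord(O_K^⊳)` of `Φ₀` send `ord(p)` to `ord(p)` (a ring homomorphism fixes `p`).
[cite: MochizukiFrdII2008, Ex 1.1 (i) p.7] -/
theorem ordIntMapOfHom_ordP {X Y : PadicFld.{u} p} (f : X ⟶ Y) :
    ordIntMapOfHom f.alg f.isValHom Y.ordP = X.ordP := by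
  rw [ordP, ordP, ordIntMapOfHom_mk]
  refine congrArg Associates.mk (Subtype.ext ?_)
  change f.alg ((p : ℕ) : Y.K) = ((p : ℕ) : X.K)
  exact map_natCast f.alg p

/-- For a `p`-adic local field (`IsPadicLocal`: finite over `ℚ_p` with the `p`-adic valuation),
`ord(O_K^⊳) ≅ ℤ_{≥0}` (abc-iut-L1-d10's `isZMonoprime_ordInt`, hypotheses discharged from `IsPadicLocal`).
[cite: MochizukiFrdII2008, Ex 1.1 (i) p.7] -/
theorem IsPadicLocal.isZMonoprime_ordInt {X : PadicFld.{u} p} (hX : X.IsPadicLocal) :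
    IsZMonoprime (OrdInt X.K) := by
  obtain ⟨inst, hfin, hc⟩ := hX.exists_finite
  letI := inst
  haveI := hfin
  exact PadicFld.isZMonoprime_ordInt X hc

/-- Hence `ord(O_K^⊳)` is monoprime for a `p`-adic local field (the hypothesis `hmono` of `Datum.zero`,
discharged from `IsPadicLocal`). [cite: MochizukiFrdII2008, Ex 1.1 (i) p.7] -/
theorem IsPadicLocal.isMonoprime_ordInt {X : PadicFld.{u} p} (hX : X.IsPadicLocal) :
    IsMonoprime (OrdInt X.K) :=
  IsMonoprime.ofZ hX.isZMonoprime_ordInt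

/-- **The normalised `p`-adic order** `ord_p : ord(O_K^⊳) → ℝ_{≥0}` of a `p`-adic local field `K`: the unique
monoid homomorphism with `ord_p(p) = 1` (on a uniformiser it takes the value `1/e(K/ℚ_p)`). It is the
element of `Hom(ord(O_K^⊳), ℝ_{≥0})` at which `ord(O_K^⊳)^rlf` is evaluated to identify it with `ℝ_{≥0}`.
[cite: MochizukiFrdII2008, Ex 1.1 (i) p.7] -/
noncomputable def pExponent (X : PadicFld.{u} p) (hX : X.IsPadicLocal) : RDual (OrdInt X.K) :=
  Classical.choose (hX.isZMonoprime_ordInt.exists_rDual_apply_eq X.ordP_ne_one 1)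

/-- `ord_p(p) = 1`. [cite: MochizukiFrdII2008, Ex 1.1 (i) p.7] -/
theorem pExponent_ordP (X : PadicFld.{u} p) (hX : X.IsPadicLocal) :
    pExponent X hX X.ordP = Multiplicative.ofAdd 1 :=
  Classical.choose_spec (hX.isZMonoprime_ordInt.exists_rDual_apply_eq X.ordP_ne_one 1)

/-- Uniqueness: a homomorphism `ord(O_K^⊳) → ℝ_{≥0}` with value `1` at `p` is `ord_p`.
[cite: MochizukiFrdII2008, Ex 1.1 (i) p.7] -/
theorem eq_pExponent (X : PadicFld.{u} p) (hX : X.IsPadicLocal) {g : RDual (OrdInt X.K)}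
    (hg : g X.ordP = Multiplicative.ofAdd 1) : g = pExponent X hX :=
  hX.isZMonoprime_ordInt.rDual_ext X.ordP_ne_one (hg.trans (pExponent_ordP X hX).symm)

/-- `ord_p ≠ 1` (it takes the value `1 ≠ 0` at `p`). [cite: MochizukiFrdII2008, Ex 1.1 (i) p.7] -/
theorem pExponent_ne_one (X : PadicFld.{u} p) (hX : X.IsPadicLocal) : pExponent X hX ≠ 1 := fun h => by
  have h1 := pExponent_ordP X hX
  rw [h, MonoidHom.one_apply] at h1
  exact one_ne_zero (Multiplicative.ofAdd.injective (ofAdd_zero.trans h1)).symm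

/-- **Naturality of `ord_p`**: along `Spec K → Spec L` (a valuative `L → K`) the normalised order of `K`
restricts to that of `L` — both take the value `1` at `p`. [cite: MochizukiFrdII2008, Ex 1.1 (i) p.7] -/
theorem pExponent_comp_ordIntMapOfHom {X Y : PadicFld.{u} p} (hX : X.IsPadicLocal) (hY : Y.IsPadicLocal)
    (f : X ⟶ Y) : (pExponent X hX).comp (ordIntMapOfHom f.alg f.isValHom) = pExponent Y hY :=
  eq_pExponent Y hY (by rw [MonoidHom.comp_apply, ordIntMapOfHom_ordP, pExponent_ordP])

end PadicFld

/-! ### Example 1.1 (i): `Φ₀|_D ≅` the constant monoid `ℝ_{≥0}` -/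

section ConstantMonoid

variable {D : Type u} [Category.{v} D] {p : ℕ} [Fact p.Prime]
  (base : D ⥤ PadicFld.{u} p) (hloc : ∀ A : D, (base.obj A).IsPadicLocal)

/-- The component at `A ↦ Spec K` of the identification: `Φ₀(A) = ord(O_K^⊳) ⊗ ℝ_{≥0} ≅ ℝ_{≥0}`,
evaluation at the normalised order `ord_p` (FrdII Ex. 1.1 (i), p. 7: "`ord(O_K^⊳)^rlf (≅ ℝ_{≥0})`").
[cite: MochizukiFrdII2008, Ex 1.1 (i) p.7] -/
noncomputable def phiZeroEquiv (A : Dᵒᵖ) :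
    Realification (OrdInt (base.obj A.unop).K) ≃* Multiplicative ℝ≥0 :=
  MulEquiv.ofBijective (Realification.evalAt (PadicFld.pExponent (base.obj A.unop) (hloc A.unop)))
    (Realification.evalAt_bijective (hloc A.unop).isZMonoprime_ordInt
      (PadicFld.pExponent_ne_one (base.obj A.unop) (hloc A.unop)))

/-- The value of the component: evaluation at `ord_p`. [cite: MochizukiFrdII2008, Ex 1.1 (i) p.7] -/
theorem phiZeroEquiv_apply (A : Dᵒᵖ) (x : Realification (OrdInt (base.obj A.unop).K)) :
    phiZeroEquiv base hloc A x = x.toHom (PadicFld.pExponent (base.obj A.unop) (hloc A.unop)) := rfl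

/-- On `ord(O_K^⊳) ⊆ Φ₀(A)` the identification is `ord_p`; in particular `ord(p) ⊗ 1 ↦ 1`.
[cite: MochizukiFrdII2008, Ex 1.1 (i) p.7] -/
theorem phiZeroEquiv_of (A : Dᵒᵖ) (a : OrdInt (base.obj A.unop).K) :
    phiZeroEquiv base hloc A (Realification.of _ a) = PadicFld.pExponent (base.obj A.unop) (hloc A.unop) a :=
  rfl

/-- `ord(p) ⊗ 1 ↦ 1`. [cite: MochizukiFrdII2008, Ex 1.1 (i) p.7] -/
theorem phiZeroEquiv_of_ordP (A : Dᵒᵖ) :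
    phiZeroEquiv base hloc A (Realification.of _ (base.obj A.unop).ordP) = Multiplicative.ofAdd 1 := by
  rw [phiZeroEquiv_of, PadicFld.pExponent_ordP]

/-- **Naturality**: the identifications commute with the pull-back maps of `Φ₀|_D` (which become the
identity of `ℝ_{≥0}`). [cite: MochizukiFrdII2008, Ex 1.1 (i) p.8] -/
theorem phiZeroEquiv_naturality {A B : Dᵒᵖ} (f : A ⟶ B) (x : Realification (OrdInt (base.obj A.unop).K)) :
    phiZeroEquiv base hloc B (((phiZeroOn base).map f).hom x) = phiZeroEquiv base hloc A x := by
  change Realification.evalAt (PadicFld.pExponent (base.obj B.unop) (hloc B.unop))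
      (Realification.map (ordIntMapOfHom (base.map f.unop).alg (base.map f.unop).isValHom) x) =
    Realification.evalAt (PadicFld.pExponent (base.obj A.unop) (hloc A.unop)) x
  rw [Realification.evalAt_map, PadicFld.pExponent_comp_ordIntMapOfHom (hloc B.unop) (hloc A.unop)]

/-- "The constant monoid determined by `ℝ_{≥0} ∈ Ob(Mon)` on `D`" (FrdII Ex. 1.1 (i), p. 8; [FrdI] Def. 1.1):
the constant functor `D^op → Mon` with value `ℝ_{≥0}` (lifted to the universe of `Φ₀|_D`).
[cite: MochizukiFrdII2008, Ex 1.1 (i) p.8] -/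
abbrev constNNReal (D : Type u) [Category.{v} D] : Dᵒᵖ ⥤ CommMonCat.{u} :=
  (Functor.const Dᵒᵖ).obj (CommMonCat.of (ULift.{u} (Multiplicative ℝ≥0)))

/-- **Example 1.1 (i)** (FrdII p. 8): "the monoid `Φ₀^Λ` is isomorphic to the constant monoid determined by
`ℝ_{≥0} ∈ Ob(Mon)` on `D₀`" — the isomorphism of functors `Φ₀|_D ≅ ℝ_{≥0}` for any base `D → D₀` of `p`-adic
local fields (`D = D₀` included), componentwise evaluation at `ord_p`. [cite: MochizukiFrdII2008, Ex 1.1 (i) p.8] -/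
noncomputable def phiZeroIsoConst : phiZeroOn base ≅ constNNReal D :=
  NatIso.ofComponents
    (fun A => ((phiZeroEquiv base hloc A).trans MulEquiv.ulift.symm).toCommMonCatIso)
    (fun {A B} f => by
      apply CommMonCat.hom_ext
      refine MonoidHom.ext fun x => ?_
      change MulEquiv.ulift.symm (phiZeroEquiv base hloc B (((phiZeroOn base).map f).hom x)) =
        MulEquiv.ulift.symm (phiZeroEquiv base hloc A x)
      rw [phiZeroEquiv_naturality])

/-- The component of `phiZeroIsoConst` at `A`, on elements. [cite: MochizukiFrdII2008, Ex 1.1 (i) p.8] -/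
theorem phiZeroIsoConst_hom_app_apply (A : Dᵒᵖ) (x : Realification (OrdInt (base.obj A.unop).K)) :
    ((phiZeroIsoConst base hloc).hom.app A).hom x = ULift.up (phiZeroEquiv base hloc A x) := rfl

include hloc in
/-- **Example 1.1 (i)**, the printed claim as a proposition: `Φ₀|_D` IS isomorphic to the constant monoid
`ℝ_{≥0}` on `D`. [cite: MochizukiFrdII2008, Ex 1.1 (i) p.8] -/
theorem nonempty_phiZeroOn_iso_const : Nonempty (phiZeroOn base ≅ constNNReal D) :=
  ⟨phiZeroIsoConst base hloc⟩

include hloc in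
/-- In particular every pull-back map of `Φ₀|_D` is bijective (cf. abc-iut-L1-t4's `phi0Map_bijective`,
here recovered from the isomorphism with a constant functor). [cite: MochizukiFrdII2008, Ex 1.1 (i) p.8] -/
theorem phiZeroOn_map_bijective {A B : Dᵒᵖ} (f : A ⟶ B) : Bijective ((phiZeroOn base).map f).hom := by
  have h : ∀ x, ((phiZeroOn base).map f).hom x =
      (phiZeroEquiv base hloc B).symm (phiZeroEquiv base hloc A x) := fun x => by
    apply (phiZeroEquiv base hloc B).injective
    rw [MulEquiv.apply_symm_apply, phiZeroEquiv_naturality]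
  have h' : (fun x => ((phiZeroOn base).map f).hom x) =
      (phiZeroEquiv base hloc B).symm ∘ (phiZeroEquiv base hloc A) := funext h
  change Bijective (fun x => ((phiZeroOn base).map f).hom x)
  rw [h']
  exact (phiZeroEquiv base hloc B).symm.bijective.comp (phiZeroEquiv base hloc A).bijective

end ConstantMonoid

end PadicFrd

end Literature.AlgebraicGeometry.Frobenioids
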